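import Summits.QuantumFields.YangMills.Theorems.FlatTubeReductionFlatKacAnnulus
import Summits.QuantumFields.YangMills.Theorems.FlatTubeReductionAnnulusJump
import Summits.QuantumFields.YangMills.Theorems.FlatTubeReductionOuterCoerciveSeam
import HarnessLib

/-!
# ★★★ `stub_outerCoercive` of «ratepack-v2» PROVED: one-site OUTER COERCIVITY AT THE EIGEN-SCALE (B. Simon's confinement for the lattice transfer operator)
# (route `FlatTubeReduction`, crux K1 `NearFlatRatioLaw` stmt-QuantumFields-24720, skeleton «ratepack-v2»; seat `ym-line-ftr-p1` g11; R2b1 RECORD rung — no summit statement is proved here)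

For every `E` there are `R(E) > 0`, `B₁`, `C` such that every physical one-site test function vanishing on the eight toron windows `⋃_z {orbitDist(τ_z ·) < R·λ_b(B)}` has
`⟨ψ, K_B ψ⟩ ≤ linkC(B)³ · e^{−Eλ_b(B) + Cλ_b(B)²} · ‖ψ‖²` for `B ≥ B₁` (`absRate_eigenScale`); hence (`outerCoercive_of_absRate`, p665730) the registered stub `stub_outerCoercive`
(relative currency `(1 − E'λ_b)·λ₀`), and with it the one-site sub-target (EM) `OneSiteEigenMoments` (`oneSiteEigenMoments_of_outerCoercive`, p665071).
Proof = IMS split along crux ONE's phase `Θ_B` (`qform_le_localized_cos_sin`, defect `O(λ_b²)·linkCE`): the `sin Θ_B`-piece is crux ONE's landed OUTER at a level `N` with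
`physLevel (N+1) ≥ E` (`absUpperOuter_of_valleyMag`); the `cos Θ_B`-piece is `cosRate_of_flatAnnulus` (crux ONE's Kac comparison with a support condition) fed with the flat annulus
Kac-form bound `flatKac_annulus` (B. Simon confinement for `𝔥 = −½Δ + ¼Σ|x_i × x_j|²` in Kac-form currency); the additive defect is absorbed into the exponent (`exp_add_defect_le`).
HONEST FRAMING: one registered stub of one line of crux K1 (the other two, `stub_coreRateOfEM` and `stub_shellGainSmall`, remain OPEN); femto rung R2b1 (RECORD label); not infinite
volume, not a mass gap, not Clay.  No defs, no named-fact hypotheses, no `sorry`.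
-/

set_option autoImplicit false

noncomputable section

open MeasureTheory Filter Topology Real
open scoped BigOperators
open Literature.MathematicalPhysics.QuantumFieldTheory
open Literature.MathematicalPhysics.QuantumLattice
open Literature.Analysis.OperatorTheory.YMMatrixModel

namespace Summit.QuantumFields.YangMills.Theorems.FemtoTransferGap.RateTube

open Summit.QuantumFields.YangMills.Theorems.FemtoTransferGap

set_option maxHeartbeats 400000 in
/-- ★★★ **(OC-abs): the eigen-scale outer coercivity in absolute currency, `E` arbitrary.**  For every `E` there are `R > 0`, `B₁`, `C` with
`⟨ψ,K_Bψ⟩ ≤ linkC B³·e^{−Eλ_b + Cλ_b²}‖ψ‖²` (`B ≥ B₁`) for every physical `ψ` vanishing on `⋃_z {orbitDist(τ_z ·) < Rλ_b(B)}`.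
[cite: SimonB1983DiscreteSpectrum, §3] [cite: Luscher1983, §2–§3] -/
theorem absRate_eigenScale :
    ∀ E : ℝ, ∃ R B₁ C : ℝ, 0 < R ∧ ∀ B : ℝ, B₁ ≤ B → ∀ ψ : GaugeConfig 3 1 SU2 → ℝ, IsPhys ψ →
      (∀ U, ψ U ≠ 0 → ∀ z : Fin 3 → Bool, R * bareLambda B ≤ orbitDist (TT.twist3 z U)) →
        qform su2Rep B ψ ψ ≤ linkC B ^ 3 * Real.exp (-(E * bareLambda B) + C * bareLambda B ^ 2) * l2 ψ ψ := by
  intro E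
  set Ep : ℝ := max E 0 with hEp
  have hEp0 : 0 ≤ Ep := le_max_right _ _
  have hEEp : E ≤ Ep := le_max_left _ _
  -- a level `N` with `physLevel (N+1) ≥ E⁺`, and crux ONE's OUTER at that level
  obtain ⟨htend, -⟩ := LuscherSimonGap_holds
  obtain ⟨N, hN⟩ := (Filter.tendsto_atTop_atTop.mp htend) Ep
  have hEN : Ep ≤ physLevel (N + 1) := hN (N + 1) (Nat.le_succ N)
  obtain ⟨Cv, Bv, hBv, hval⟩ := oneSiteAbsUpperValleyMag N
  obtain ⟨C₂, B₂, hB₂, hout⟩ := absUpperOuter_of_valleyMag N hBv hval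
  -- the `cos Θ_B`-piece: Kac comparison with a support condition + the flat annulus bound
  obtain ⟨R, B₁, C₁, hR, -, hin⟩ := cosRate_of_flatAnnulus (flatKac_annulus (E := Ep) (κ := 7) hEp0)
  set D : ℝ := (9 / 4) * (Real.pi ^ 2 / 4) * cM2 with hDdef
  have hD0 : 0 ≤ D := by rw [hDdef]; have := cM2_pos; positivity
  set C' : ℝ := max C₁ C₂ with hC'
  refine ⟨R, max (max B₁ B₂) 2, C' + D * Real.exp (|Ep| + |C'|), hR, fun B hB ψ hψ hsupp => ?_⟩
  have hB1' : B₁ ≤ B := ((le_max_left _ _).trans (le_max_left _ _)).trans hB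
  have hB2' : B₂ ≤ B := ((le_max_right _ _).trans (le_max_left _ _)).trans hB
  have hB2 : 2 ≤ B := (le_max_right _ _).trans hB
  have hB0 : 0 < B := by linarith
  set lam := bareLambda B with hlam
  have hlam0 : 0 < lam := bareLambda_pos' hB0
  have hlam1 : lam ≤ 1 := by
    have h2B : 2 / (1 : ℝ) ^ 3 ≤ B := by rw [one_pow, div_one]; exact hB2
    have h := bareLambda_cube_le (L := 1) (zero_lt_one : (0 : ℝ) < 1) h2B
    have e1B : ((1 : ℕ) : ℝ) ^ 3 * B = B := by simp
    rw [e1B] at h; exact h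
  have hCE : linkCE B = linkC B ^ 3 := by rw [linkCE, card_edge_one]
  have hlink : 0 ≤ linkC B ^ 3 := pow_nonneg (linkC_pos hB0.le).le 3
  -- the IMS split along crux ONE's phase
  set ℓ := onePhaseScale B with hℓ
  have hℓ0 : 0 < ℓ := onePhaseScale_pos hB0
  have hΛ0 : 0 ≤ Real.pi / 2 / ℓ := by positivity
  have hims := qform_le_localized_cos_sin hB0 (measurable_onePhase ℓ) hΛ0 (abs_onePhase_sub_le hℓ0) (onePhase_gaugeTransform ℓ)
    (fun k z hz U => onePhase_twist ℓ k hz U) hψ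
  have hdef := defect_scale hB0 (onePhaseScale_lipschitzSq hB0)
  set nc : ℝ := l2 (fun U => Real.cos (onePhase ℓ U) * ψ U) (fun U => Real.cos (onePhase ℓ U) * ψ U) with hnc
  set ns : ℝ := l2 (fun U => Real.sin (onePhase ℓ U) * ψ U) (fun U => Real.sin (onePhase ℓ U) * ψ U) with hns
  set Nn : ℝ := l2 ψ ψ with hNn
  have hnc0 : 0 ≤ nc := l2_self_nonneg_lat _
  have hns0 : 0 ≤ ns := l2_self_nonneg_lat _
  have hN0 : 0 ≤ Nn := l2_self_nonneg_lat _
  have hsum : nc + ns = Nn := l2_cos_add_l2_sin (measurable_onePhase ℓ) hψ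
  -- inner piece
  have hcos : qform su2Rep B (fun U => Real.cos (onePhase ℓ U) * ψ U) (fun U => Real.cos (onePhase ℓ U) * ψ U)
      ≤ linkC B ^ 3 * Real.exp (-(Ep * lam) + C₁ * lam ^ 2) * nc := by
    have h := hin B hB1' ψ hψ hsupp
    rw [hCE] at h
    exact h
  -- outer piece: crux ONE's OUTER at level `N`
  have hsin : qform su2Rep B (fun U => Real.sin (onePhase ℓ U) * ψ U) (fun U => Real.sin (onePhase ℓ U) * ψ U)
      ≤ linkC B ^ 3 * Real.exp (-(Ep * lam) + C₂ * lam ^ 2) * ns := by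
    refine (hout B hB2' ψ hψ).trans ?_
    rw [hCE]
    refine mul_le_mul_of_nonneg_right (mul_le_mul_of_nonneg_left (Real.exp_le_exp.mpr ?_) hlink) hns0
    have := mul_le_mul_of_nonneg_right hEN hlam0.le
    linarith
  -- common exponent `C'`
  have hrate : ∀ {Cx : ℝ}, Cx ≤ C' → Real.exp (-(Ep * lam) + Cx * lam ^ 2) ≤ Real.exp (-(Ep * lam) + C' * lam ^ 2) := by
    intro Cx hCx; exact Real.exp_le_exp.mpr (by nlinarith [sq_nonneg lam])
  have h1 : qform su2Rep B ψ ψ ≤ linkC B ^ 3 * Real.exp (-(Ep * lam) + C' * lam ^ 2) * Nn + linkC B ^ 3 * (D * lam ^ 2) * Nn := by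
    have hc' := mul_le_mul_of_nonneg_right (mul_le_mul_of_nonneg_left (hrate (le_max_left C₁ C₂)) hlink) hnc0
    have hs' := mul_le_mul_of_nonneg_right (mul_le_mul_of_nonneg_left (hrate (le_max_right C₁ C₂)) hlink) hns0
    have hd' : (1 / 2) * (9 * (Real.pi / 2 / ℓ) ^ 2 * (cM2 / B) * linkCE B) * Nn ≤ linkC B ^ 3 * (D * lam ^ 2) * Nn := by
      rw [hCE]
      refine mul_le_mul_of_nonneg_right ?_ hN0
      have := mul_le_mul_of_nonneg_right hdef hlink
      rw [hDdef]; nlinarith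
    have hsplit : linkC B ^ 3 * Real.exp (-(Ep * lam) + C' * lam ^ 2) * nc + linkC B ^ 3 * Real.exp (-(Ep * lam) + C' * lam ^ 2) * ns
        = linkC B ^ 3 * Real.exp (-(Ep * lam) + C' * lam ^ 2) * Nn := by rw [← hsum]; ring
    linarith [hims, hcos, hsin, hc', hs', hd', hsplit]
  have h2 := exp_add_defect_le (E := Ep) (C' := C') hD0 hlam0.le hlam1
  -- `E ≤ E⁺`
  have h3 : Real.exp (-(Ep * lam) + (C' + D * Real.exp (|Ep| + |C'|)) * lam ^ 2)
      ≤ Real.exp (-(E * lam) + (C' + D * Real.exp (|Ep| + |C'|)) * lam ^ 2) :=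
    Real.exp_le_exp.mpr (by nlinarith [mul_le_mul_of_nonneg_right hEEp hlam0.le])
  calc qform su2Rep B ψ ψ ≤ linkC B ^ 3 * (Real.exp (-(Ep * lam) + C' * lam ^ 2) + D * lam ^ 2) * Nn := by rw [mul_add, add_mul]; exact h1
    _ ≤ linkC B ^ 3 * Real.exp (-(Ep * lam) + (C' + D * Real.exp (|Ep| + |C'|)) * lam ^ 2) * Nn :=
        mul_le_mul_of_nonneg_right (mul_le_mul_of_nonneg_left h2 hlink) hN0
    _ ≤ linkC B ^ 3 * Real.exp (-(E * lam) + (C' + D * Real.exp (|Ep| + |C'|)) * lam ^ 2) * Nn :=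
        mul_le_mul_of_nonneg_right (mul_le_mul_of_nonneg_left h3 hlink) hN0

/-- ★★★ **(OC) — ONE-SITE OUTER COERCIVITY AT THE EIGEN-SCALE** (the registered stub `stub_outerCoercive` of «ratepack-v2», relative currency): for every `E'` there are `R > 0`, `B₁` such
that every physical function vanishing on the eight toron windows of radius `R·λ_b(B)` has Rayleigh quotient `≤ (1 − E'λ_b(B))·λ₀(B)` (`B ≥ B₁`).
[cite: SimonB1983DiscreteSpectrum, §3] [cite: Luscher1983, §2] -/
theorem outerCoercive :
    ∀ E' : ℝ, ∃ R B₁ : ℝ, 0 < R ∧ ∀ B : ℝ, B₁ ≤ B → ∀ ψ : GaugeConfig 3 1 SU2 → ℝ, IsPhys ψ →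
      (∀ U, ψ U ≠ 0 → ∀ z : Fin 3 → Bool, R * bareLambda B ≤ orbitDist (TT.twist3 z U)) →
        qform su2Rep B ψ ψ ≤ (1 - E' * bareLambda B) * levelValue su2Rep 1 B 0 * l2 ψ ψ :=
  outerCoercive_of_absRate absRate_eigenScale

/-- ★★★ **The registered stub `stub_outerCoercive` of skeleton «ratepack-v2» (crux K1 `NearFlatRatioLaw`, stmt-QuantumFields-24720) BY NAME and signature.**
[cite: SimonB1983DiscreteSpectrum, §3] [cite: Luscher1983, §2] -/
theorem stub_outerCoercive :
    ∀ E' : ℝ, ∃ R B₁ : ℝ, 0 < R ∧ ∀ B : ℝ, B₁ ≤ B → ∀ ψ : GaugeConfig 3 1 SU2 → ℝ, IsPhys ψ →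
      (∀ U, ψ U ≠ 0 → ∀ z : Fin 3 → Bool, R * bareLambda B ≤ orbitDist (TT.twist3 z U)) →
        qform su2Rep B ψ ψ ≤ (1 - E' * bareLambda B) * levelValue su2Rep 1 B 0 * l2 ψ ψ :=
  outerCoercive

/-- ★★ **(EM) `OneSiteEigenMoments` — the one-site sub-target of «ratepack-v2» — now UNCONDITIONAL** (moment bootstrap `oneSiteEigenMoments_of_outerCoercive`, p665071, fed with (OC)).
[cite: SimonB1983DiscreteSpectrum, §3] [cite: Luscher1983, §2] -/
theorem oneSiteEigenMoments : OneSiteEigenMoments :=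
  oneSiteEigenMoments_of_outerCoercive outerCoercive

end Summit.QuantumFields.YangMills.Theorems.FemtoTransferGap.RateTube

end
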